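import Summits.BirchSwinnertonDyer.BirchSwinnertonDyer.Theorems.EisensteinPrimesGoodLatticeKatzMeasurePeriodRigidityAnyType
import Summits.BirchSwinnertonDyer.BirchSwinnertonDyer.Theorems.PrintCf2RubinValueTwoValueRigidityOfCharIdeal
import Literature.NumberTheory.EllipticCurves.IntSeriesOnePlusPowMul
import Literature.NumberTheory.GaloisRepresentations.HeckeCharacterMuAlgGalConjTwist
import HarnessLib

set_option linter.dupNamespace false
set_option autoImplicit false

/-!
# VALUES OF THE TWO-VARIABLE PERIOD-RIGIDITY UNIT `U = G'/G`: the explicit constant `A^{a+b}B^b` at the point of every listing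
# twist, multiplicativity on the bidisc, and triviality on the FINITE-ORDER characters of the tower unramified off `v̄`

Cell `bsd-eis` (run/shared/lean/pub/bsd-eis/), width seat `bsd-line-x1-p1-w2` gen 32; `--supports stmt-BirchSwinnertonDyer-19032`
(crux 2 `GoodLatticeBDPValue`, line `halves` v34N; helper, closes nothing by itself).  File 4 of the thmII64 certificates
(`…KatzMeasureUniqueness`, `…Binders`, `…PeriodRigidityAnyType`).  THEOREMS ONLY (no `def`, no named fact, no `sorry`).

WHAT.  Let `G ≠ 0`, `G'` be frames of ONE branch `λ` of de Shalit's two-variable measure (`IsKatzMeasure₂`, topological generator pair)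
at two period triples `(Ω, δ, Ω_p)`, `(Ω', δ', Ω_p')`, and `U` the unit with `G' = U·G` (file 3; unique, `𝒪_{ℂ_p}⟦T₁⟧⟦T₂⟧` is a domain).
Write `A = ι⁻¹(Ω/Ω')·Ω_p'/Ω_p`, `B = ι⁻¹(δ/δ')`.

* §1 `onePlusPow_mul_base` (`(1+X)^c` is group-like: `onePlusPow c (ab − 1) = onePlusPow c (a−1)·onePlusPow c (b−1)`, continuity in
  `c ∈ ℤ_p` + the binomial theorem on `ℕ`), `hasValueAt₂_map_C` / `hasValueAt₂_C` (values of an outer / inner one-variable series on the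
  bidisc), `hasValueAt₂_twistedUnit` (the value of `unitTwist₂ (C(C c₀)·(1+T₁)^x(1+T₂)^w) s₁ s₂` at `(X, Y)` is
  `c₀·onePlusPow x (s₁(1+X) − 1)·onePlusPow w (s₂(1+Y) − 1)`).
* §2 `hasValueAt₂_rigidityUnit_at_listing_twist` — **at the point `(η̂(γ₁) − 1, η̂(γ₂) − 1)` of ANY listing twist `η` (through the
  pair, unramified off `v̄`, `λη` of type `(−a, b)` with natural `b ≤ a`) the unit takes the EXPLICIT value `A^{a+b}·B^{b}`** — file 3's
  rigidity through `η` composed with the domain property and §1 (the twisted point is the origin of the un-twisted series).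
* §3 `hasValueAt₂_rigidityUnit_at_finiteOrder` — **`U` takes the SAME value at the point of every FINITE-ORDER character `ν` of the
  tower unramified off `v̄` as at the origin** (`λνη` and `λη` have the same type for a listing `η`; §2 twice; multiplicativity §1):
  the period ratio between two normalisations is blind to the `p`-power-conductor twists at `v̄` — the torsion part of de Shalit's
  "enough admissible `ε_G` to separate points in `𝐃[[G]]`" (II.6.4, p. 85) on the period axis.

WHY (crux 2, the typed II.6.4 `DeShalit1987.thmII64_katzMeasure₂_functionalEquation`).  Files 1–3 settle the ∀-frame phrasing at fixed
data and give unit / ideal rigidity across period triples for BOTH branches `λ`, `λ̌`.  What the typed fact claims beyond print is the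
EXISTENCE of a `λ̌`-frame at a non-admissible period triple carrying a `λ`-frame; the natural candidate is `κ·U·Ǧ₀` (`Ǧ₀` the `λ̌`-frame
at the admissible triple), and it IS a frame iff `U` takes the value `A^{m'+j'}B^{j'}` at the point of EVERY interpolation pair
`(ρ', r')` of `λ̌`.  §2 gives this on the lattice of listing twists, §3 on its translates by the finite-order characters of the
`ℤ_p`-extension unramified outside `v̄`; the residual (recorded, not proved): interpolation pairs whose point lies outside the
`ℤ_p`-saturation of that set (types outside the `Ψ₁`-lattice, whose avatar values above `p` the frame predicate's weak avatar notion
`IsPAdicAvatarOf` does not pin).  HONEST FRAMING: helper theorems; nothing here proves a summit statement, the crux, a stub, BSD, or a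
theorem of de Shalit / Katz / Rubin; 0 cells / labels / tiers move.

References: [deShalit1987] II.4.12 Remarks (iii)–(iv), II.4.17 (51)–(54) (store chunk 77–78), II.6.4 proof (store chunk 85);
[Gouvea1993PadicNumbers] §5.9; [LiTianYanZhu2025] §7 (7.3).
-/

noncomputable section

open scoped NumberField Classical Topology
open Filter NumberField IsDedekindDomain Field
open Literature Literature.NumberTheory.GaloisRepresentations Literature.NumberTheory.EllipticCurves
open Summit.BirchSwinnertonDyer.Rank1Residual.X11b Summit.BirchSwinnertonDyer.Rank1Residual.X11b.LambdaSupply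
open Summit.BirchSwinnertonDyer.Rank1Residual.X11b.Three.LambdaSupply
open Summit.BirchSwinnertonDyer.BirchSwinnertonDyer.Theorems.GoodLatticeKatzMeasureUniqueness
open Summit.BirchSwinnertonDyer.BirchSwinnertonDyer.Theorems.GoodLatticeKatzMeasureUniquenessBinders
open Summit.BirchSwinnertonDyer.BirchSwinnertonDyer.Theorems.GoodLatticeKatzMeasurePeriodRigidity

namespace Summit.BirchSwinnertonDyer.BirchSwinnertonDyer.Theorems.GoodLatticeKatzMeasureRigidityUnitValues

variable {p : ℕ} [Fact p.Prime]

/-! ### §1 Analysis on the bidisc: group-likeness of `(1+X)^c`, values of outer/inner series and of the twisted unit -/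

/-- Products of principal units are principal units. [folklore] -/
theorem norm_mul_sub_one_lt {a b : ℂ_[p]} (ha : ‖a - 1‖ < 1) (hb : ‖b - 1‖ < 1) : ‖a * b - 1‖ < 1 := by
  have e : a * b - 1 = (a - 1) * b + (b - 1) := by ring
  rw [e]
  refine (IsUltrametricDist.norm_add_le_max _ _).trans_lt (max_lt ?_ hb)
  rw [norm_mul, R1.norm_eq_one_of_norm_sub_one_lt hb, mul_one]
  exact ha

/-- The twisted point `u(1+x) − 1` lies in the open disc. [folklore] -/
theorem norm_twistPt_lt {u x : ℂ_[p]} (hu : ‖u - 1‖ < 1) (hx : ‖x‖ < 1) : ‖u * (1 + x) - 1‖ < 1 :=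
  norm_mul_sub_one_lt hu (b := 1 + x) (by rwa [add_sub_cancel_left])

/-- **`(1+X)^c` is group-like**: `onePlusPow c (ab − 1) = onePlusPow c (a − 1) · onePlusPow c (b − 1)` for principal units `a, b`
(both sides are continuous in `c ∈ ℤ_p` and agree on `ℕ` by the binomial theorem). [cite: Gouvea1993PadicNumbers, §5.9] -/
theorem onePlusPow_mul_base (c : ℤ_[p]) {a b : ℂ_[p]} (ha : ‖a - 1‖ < 1) (hb : ‖b - 1‖ < 1) :
    IntSeries.onePlusPow c (a * b - 1) = IntSeries.onePlusPow c (a - 1) * IntSeries.onePlusPow c (b - 1) := by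
  have hab : ‖a * b - 1‖ < 1 := norm_mul_sub_one_lt ha hb
  have key : (fun c : ℤ_[p] ↦ IntSeries.onePlusPow c (a * b - 1)) =
      fun c ↦ IntSeries.onePlusPow c (a - 1) * IntSeries.onePlusPow c (b - 1) := by
    apply Continuous.ext_on PadicInt.denseRange_natCast (IntSeries.continuous_onePlusPow hab)
      ((IntSeries.continuous_onePlusPow ha).mul (IntSeries.continuous_onePlusPow hb))
    rintro _ ⟨m, rfl⟩
    simp only [Pi.mul_apply, IntSeries.onePlusPow_natCast, add_sub_cancel, mul_pow]
  exact congrFun key c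

/-- **Value of an OUTER one-variable series `P(T₁)` on the bidisc**: `(map C P)(x, y) = P(x)`. [cite: deShalit1987, II.4.17 (54)] -/
theorem hasValueAt₂_map_C {P : PowerSeries (PadicComplexInt p)} {x y v : ℂ_[p]} (h : IntSeries.HasValueAt P x v) :
    IntSeries.HasValueAt₂ (PowerSeries.map (PowerSeries.C (R := PadicComplexInt p)) P) x y v := by
  unfold IntSeries.HasValueAt₂
  unfold IntSeries.HasValueAt at h
  have hinj : Function.Injective (fun i : ℕ ↦ (i, (0 : ℕ))) := fun a b hab ↦ by
    simpa using congrArg Prod.fst hab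
  rw [← hinj.hasSum_iff]
  · refine (Iff.of_eq (congrArg (fun f ↦ HasSum f v) ?_)).mpr h
    funext i
    simp [Function.comp, PowerSeries.coeff_map]
  · rintro ⟨i, j⟩ hij
    rcases j with _ | j
    · exact absurd ⟨i, rfl⟩ hij
    · simp [PowerSeries.coeff_map]

/-- **Value of an INNER one-variable series `Q(T₂)` on the bidisc**: `(C Q)(x, y) = Q(y)`. [cite: deShalit1987, II.4.17 (54)] -/
theorem hasValueAt₂_C {Q : PowerSeries (PadicComplexInt p)} {x y w : ℂ_[p]} (h : IntSeries.HasValueAt Q y w) :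
    IntSeries.HasValueAt₂ (PowerSeries.C Q) x y w := by
  unfold IntSeries.HasValueAt₂
  unfold IntSeries.HasValueAt at h
  have hinj : Function.Injective (fun j : ℕ ↦ ((0 : ℕ), j)) := fun a b hab ↦ by
    simpa using congrArg Prod.snd hab
  rw [← hinj.hasSum_iff]
  · refine (Iff.of_eq (congrArg (fun f ↦ HasSum f w) ?_)).mpr h
    funext j
    simp [Function.comp, PowerSeries.coeff_C]
  · rintro ⟨i, j⟩ hij
    rcases i with _ | i
    · exact absurd ⟨j, rfl⟩ hij
    · simp

/-- **The value of the twisted unit** `unitTwist₂ (C(C c₀)·(1+T₁)^x(1+T₂)^w) s₁ s₂` at a point `(X, Y)` of the bidisc is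
`c₀ · onePlusPow x (s₁(1+X) − 1) · onePlusPow w (s₂(1+Y) − 1)`. [cite: deShalit1987, II.4.17 (52)–(54)] -/
theorem hasValueAt₂_twistedUnit {c₀ s₁ s₂ : PadicComplexInt p} {x w : ℤ_[p]} (hs₁ : ‖(s₁ : ℂ_[p]) - 1‖ < 1)
    (hs₂ : ‖(s₂ : ℂ_[p]) - 1‖ < 1) {X Y : ℂ_[p]} (hX : ‖X‖ < 1) (hY : ‖Y‖ < 1) :
    IntSeries.HasValueAt₂ (IntSeries.unitTwist₂ (PowerSeries.C (PowerSeries.C c₀) *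
        (PowerSeries.map (PowerSeries.C (R := PadicComplexInt p)) (IntSeries.binomPow x) *
          PowerSeries.C (IntSeries.binomPow w))) s₁ s₂) X Y
      ((c₀ : ℂ_[p]) * (IntSeries.onePlusPow x ((s₁ : ℂ_[p]) * (1 + X) - 1) *
        IntSeries.onePlusPow w ((s₂ : ℂ_[p]) * (1 + Y) - 1))) := by
  have hX' : ‖(s₁ : ℂ_[p]) * (1 + X) - 1‖ < 1 := norm_twistPt_lt hs₁ hX
  have hY' : ‖(s₂ : ℂ_[p]) * (1 + Y) - 1‖ < 1 := norm_twistPt_lt hs₂ hY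
  rw [IntSeries.hasValueAt₂_unitTwist₂_iff _ hs₁ hs₂ hX hY]
  refine PrintCf2.RubinValueTwoReadout.hasValueAt₂_mul hX' hY' (hasValueAt₂_C (IntSeries.hasValueAt_C c₀ _)) ?_
  exact PrintCf2.RubinValueTwoReadout.hasValueAt₂_mul hX' hY' (hasValueAt₂_map_C (IntSeries.hasValueAt_binomPow x hX'))
    (hasValueAt₂_C (IntSeries.hasValueAt_binomPow w hY'))

/-- **Multiplicativity of the twisted-unit values**: with `V(t₁, t₂) := c₀·onePlusPow x (s₁t₁ − 1)·onePlusPow w (s₂t₂ − 1)`,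
`V(t₁t₁', t₂t₂')·V(1, 1) = V(t₁, t₂)·V(t₁', t₂')` for principal units `tᵢ, tᵢ'` (group-likeness §1). [cite: Gouvea1993PadicNumbers, §5.9] -/
theorem twistedUnitValue_mul {c₀ s₁ s₂ : ℂ_[p]} {x w : ℤ_[p]} (hs₁ : ‖s₁ - 1‖ < 1) (hs₂ : ‖s₂ - 1‖ < 1)
    {t₁ t₂ t₁' t₂' : ℂ_[p]} (ht₁ : ‖t₁ - 1‖ < 1) (ht₂ : ‖t₂ - 1‖ < 1) (ht₁' : ‖t₁' - 1‖ < 1) (ht₂' : ‖t₂' - 1‖ < 1) :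
    (c₀ * (IntSeries.onePlusPow x (s₁ * (t₁ * t₁') - 1) * IntSeries.onePlusPow w (s₂ * (t₂ * t₂') - 1))) *
        (c₀ * (IntSeries.onePlusPow x (s₁ * 1 - 1) * IntSeries.onePlusPow w (s₂ * 1 - 1))) =
      (c₀ * (IntSeries.onePlusPow x (s₁ * t₁ - 1) * IntSeries.onePlusPow w (s₂ * t₂ - 1))) *
        (c₀ * (IntSeries.onePlusPow x (s₁ * t₁' - 1) * IntSeries.onePlusPow w (s₂ * t₂' - 1))) := by
  have e₁ : s₁ * (t₁ * t₁') = (s₁ * t₁) * t₁' := by ring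
  have e₂ : s₂ * (t₂ * t₂') = (s₂ * t₂) * t₂' := by ring
  rw [e₁, e₂, onePlusPow_mul_base x (norm_mul_sub_one_lt hs₁ ht₁) ht₁', onePlusPow_mul_base w (norm_mul_sub_one_lt hs₂ ht₂) ht₂',
    mul_one, mul_one, show s₁ * t₁' = s₁ * t₁' from rfl,
    onePlusPow_mul_base x hs₁ ht₁', onePlusPow_mul_base w hs₂ ht₂']
  ring

/-! ### §2 The rigidity unit at the point of a listing twist: the explicit value `A^{a+b}·B^{b}` -/

variable {K : Type} [Field K] [NumberField K]

/-- **THE RIGIDITY UNIT AT THE POINT OF A LISTING TWIST.** In the setting of file 3's `exists_eq_unitTwist₂_mul_of_listing_twist`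
(`λ` any branch character unramified off `S ∪ {v̄}`, topological pair, `η` through the pair unramified off `v̄` with `λη` of type
`(−a, b)`, `b ≤ a`; `G ≠ 0`, `G'` frames at `(Ω, δ, Ω_p)`, `(Ω', δ', Ω_p')`), ANY `U` with `G' = U·G` takes at the point
`(η̂(γ₁) − 1, η̂(γ₂) − 1)` the value `A^{a+b}·B^{b}`, `A = ι⁻¹(Ω/Ω')·Ω_p'/Ω_p`, `B = ι⁻¹(δ/δ')`.
[cite: deShalit1987, II.4.12 Remarks (iii)–(iv) (p. 66–67), II.4.17 (51)–(54) (store chunk 77–78)] -/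
theorem hasValueAt₂_rigidityUnit_at_listing_twist (hK : IsImaginaryQuadratic K)
    {ι : PadicAlgCl p ≃+* ℂ} {v vbar : HeightOneSpectrum (𝓞 K)}
    (hv : ((p : ℕ) : 𝓞 K) ∈ v.asIdeal) (hvbar : ((p : ℕ) : 𝓞 K) ∈ vbar.asIdeal) (hne : vbar ≠ v)
    (hι : ∀ (w : InfinitePlace K) (d : 𝓞 K), d ∈ v.asIdeal ↔ ‖ι.symm (w.embedding (d : K))‖ < 1)
    {S : Finset (HeightOneSpectrum (𝓞 K))} {lam η : HeckeCharacter K}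
    (hlamu : ∀ w : HeightOneSpectrum (𝓞 K), w ∉ S → w ≠ vbar → lam.IsUnramifiedAt w)
    {κ₁ κ₂ : ZpExtension K p} {γ₁ γ₂ : absoluteGaloisGroup K}
    (hpair : ZpExtension.IsTopGeneratorPair κ₁ κ₂ γ₁ γ₂)
    {e : FramedGaloisRep K (PadicAlgCl p) 1} (he : IsPAdicAvatarOf ι η e) (heκ : FactorsThroughPair κ₁ κ₂ e)
    (hηu : ∀ w : HeightOneSpectrum (𝓞 K), w ≠ vbar → η.IsUnramifiedAt w)
    {a b : ℕ} (hba : b ≤ a) (hlamη : (lam * η).HasInfinityType (fun _ ↦ -(a : ℤ)) (fun _ ↦ (b : ℤ)))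
    {Ω δ Ω' δ' : ℂ} {Ωp Ωp' : ℂ_[p]} {G G' U : PowerSeries (PowerSeries (PadicComplexInt p))}
    (hG : IsKatzMeasure₂ ι v vbar S κ₁ κ₂ γ₁ γ₂ lam Ω δ Ωp G)
    (hG' : IsKatzMeasure₂ ι v vbar S κ₁ κ₂ γ₁ γ₂ lam Ω' δ' Ωp' G')
    (hΩ : Ω ≠ 0) (hδ : δ ≠ 0) (hΩp : Ωp ≠ 0) (hΩ' : Ω' ≠ 0) (hδ' : δ' ≠ 0) (hΩp' : Ωp' ≠ 0)
    (hG0 : G ≠ 0) (hU : G' = U * G) :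
    IntSeries.HasValueAt₂ U (avatarValueAt e γ₁ - 1) (avatarValueAt e γ₂ - 1)
      (((((ι.symm (Ω / Ω')) : PadicAlgCl p) : ℂ_[p]) * (Ωp' / Ωp)) ^ (a + b) *
        (((ι.symm (δ / δ')) : PadicAlgCl p) : ℂ_[p]) ^ b) := by
  obtain ⟨c₀, x, w, s₁, s₂, hs₁, hs₂, hs₁v, hs₂v, -, hc₀val, hEq⟩ := exists_eq_unitTwist₂_mul_of_listing_twist hK hv hvbar
    hne hι hlamu hpair he heκ hηu hba hlamη hG hG' hΩ hδ hΩp hΩ' hδ' hΩp' hG0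
  -- `U` IS the twisted unit (cancel `G ≠ 0` in the domain `𝒪_{ℂ_p}⟦T₁⟧⟦T₂⟧`)
  have hUeq : U = IntSeries.unitTwist₂ (PowerSeries.C (PowerSeries.C c₀) *
      (PowerSeries.map (PowerSeries.C (R := PadicComplexInt p)) (IntSeries.binomPow x) *
        PowerSeries.C (IntSeries.binomPow w))) s₁ s₂ :=
    mul_right_cancel₀ hG0 (hU.symm.trans hEq)
  have hX : ‖avatarValueAt e γ₁ - 1‖ < 1 := norm_avatarValueAt_sub_one_lt_of_factorsThroughPair heκ γ₁
  have hY : ‖avatarValueAt e γ₂ - 1‖ < 1 := norm_avatarValueAt_sub_one_lt_of_factorsThroughPair heκ γ₂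
  have he₁ : avatarValueAt e γ₁ ≠ 0 := fun h ↦ by
    have := R1.norm_eq_one_of_norm_sub_one_lt hX
    rw [h, norm_zero] at this
    exact zero_ne_one this
  have he₂ : avatarValueAt e γ₂ ≠ 0 := fun h ↦ by
    have := R1.norm_eq_one_of_norm_sub_one_lt hY
    rw [h, norm_zero] at this
    exact zero_ne_one this
  have hval := hasValueAt₂_twistedUnit (c₀ := c₀) (x := x) (w := w) hs₁ hs₂ hX hY
  rw [← hUeq] at hval
  have e₁ : (s₁ : ℂ_[p]) * (1 + (avatarValueAt e γ₁ - 1)) - 1 = 0 := by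
    rw [hs₁v, add_sub_cancel, inv_mul_cancel₀ he₁, sub_self]
  have e₂ : (s₂ : ℂ_[p]) * (1 + (avatarValueAt e γ₂ - 1)) - 1 = 0 := by
    rw [hs₂v, add_sub_cancel, inv_mul_cancel₀ he₂, sub_self]
  rw [e₁, e₂, IntSeries.onePlusPow_at_zero, IntSeries.onePlusPow_at_zero, mul_one, mul_one, hc₀val] at hval
  exact hval

/-! ### §3 The rigidity unit is trivial on the finite-order characters of the tower unramified off `v̄` -/

/-- **THE PERIOD-RIGIDITY UNIT DOES NOT SEE `p`-POWER-CONDUCTOR TWISTS AT `v̄`.** `K` imaginary quadratic (any class number),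
`p = v v̄` any split prime, `λ` of ANY constant integer type `(k, j)`, unramified off `S ∪ {v̄}`, topological pair; `G ≠ 0`, `G'` frames
of the branch `λ` at `(Ω, δ, Ω_p)`, `(Ω', δ', Ω_p')` and `U` with `G' = U·G`.  Then for every Hecke character `ν` of FINITE ORDER with a
`p`-adic avatar `e ∘ ψ` through the pair and unramified at every `w ≠ v̄`, the unit `U` takes at the point `(ν̂(γ₁) − 1, ν̂(γ₂) − 1)` the
SAME value as at the origin.  (Listing twist `η` of file 3 §1; `λη` and `λνη` have the same listed type; §2 at `η` and at `νη`;
multiplicativity §1.) [cite: deShalit1987, II.4.17 (51)–(54) (store chunk 77–78), II.6.4 proof (store chunk 85)] -/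
theorem hasValueAt₂_rigidityUnit_at_finiteOrder (hK : IsImaginaryQuadratic K)
    {ι : PadicAlgCl p ≃+* ℂ} {v vbar : HeightOneSpectrum (𝓞 K)}
    (hv : ((p : ℕ) : 𝓞 K) ∈ v.asIdeal) (hvbar : ((p : ℕ) : 𝓞 K) ∈ vbar.asIdeal) (hne : vbar ≠ v)
    (hι : ∀ (w : InfinitePlace K) (d : 𝓞 K), d ∈ v.asIdeal ↔ ‖ι.symm (w.embedding (d : K))‖ < 1)
    {S : Finset (HeightOneSpectrum (𝓞 K))} {lam : HeckeCharacter K} {kl jl : ℤ}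
    (hlam : lam.HasInfinityType (fun _ ↦ kl) (fun _ ↦ jl))
    (hlamu : ∀ w : HeightOneSpectrum (𝓞 K), w ∉ S → w ≠ vbar → lam.IsUnramifiedAt w)
    {κ₁ κ₂ : ZpExtension K p} {γ₁ γ₂ : absoluteGaloisGroup K}
    (hpair : ZpExtension.IsTopGeneratorPair κ₁ κ₂ γ₁ γ₂)
    {ν : HeckeCharacter K} (hν : ν.IsFiniteOrder) {ψν : absoluteGaloisGroup K →ₜ* (PadicAlgCl p)ˣ}
    (heν : IsPAdicAvatarOf ι ν ((FramedRep.unitsContinuousMulEquivOfUnique (Fin 1) (PadicAlgCl p) :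
        (PadicAlgCl p)ˣ →ₜ* GL (Fin 1) (PadicAlgCl p)).comp ψν))
    (hνκ : FactorsThroughPair κ₁ κ₂ ((FramedRep.unitsContinuousMulEquivOfUnique (Fin 1) (PadicAlgCl p) :
        (PadicAlgCl p)ˣ →ₜ* GL (Fin 1) (PadicAlgCl p)).comp ψν))
    (hνu : ∀ w : HeightOneSpectrum (𝓞 K), w ≠ vbar → ν.IsUnramifiedAt w)
    {Ω δ Ω' δ' : ℂ} {Ωp Ωp' : ℂ_[p]} {G G' U : PowerSeries (PowerSeries (PadicComplexInt p))}
    (hG : IsKatzMeasure₂ ι v vbar S κ₁ κ₂ γ₁ γ₂ lam Ω δ Ωp G)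
    (hG' : IsKatzMeasure₂ ι v vbar S κ₁ κ₂ γ₁ γ₂ lam Ω' δ' Ωp' G')
    (hΩ : Ω ≠ 0) (hδ : δ ≠ 0) (hΩp : Ωp ≠ 0) (hΩ' : Ω' ≠ 0) (hδ' : δ' ≠ 0) (hΩp' : Ωp' ≠ 0)
    (hG0 : G ≠ 0) (hU : G' = U * G) :
    ∃ u₀ : ℂ_[p], IntSeries.HasValueAt₂ U 0 0 u₀ ∧
      IntSeries.HasValueAt₂ U
        (avatarValueAt ((FramedRep.unitsContinuousMulEquivOfUnique (Fin 1) (PadicAlgCl p) :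
          (PadicAlgCl p)ˣ →ₜ* GL (Fin 1) (PadicAlgCl p)).comp ψν) γ₁ - 1)
        (avatarValueAt ((FramedRep.unitsContinuousMulEquivOfUnique (Fin 1) (PadicAlgCl p) :
          (PadicAlgCl p)ˣ →ₜ* GL (Fin 1) (PadicAlgCl p)).comp ψν) γ₂ - 1) u₀ := by
  set eU := (FramedRep.unitsContinuousMulEquivOfUnique (Fin 1) (PadicAlgCl p) :
    (PadicAlgCl p)ˣ →ₜ* GL (Fin 1) (PadicAlgCl p)) with heU
  -- a listing twist `η` for `λ` (and for `λν`: same type)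
  obtain ⟨η, ψ, n, hn, he, heκ, hηu, hηt⟩ := exists_listing_twist hK ι hpair (kl.natAbs + jl.natAbs)
  obtain ⟨a, b, hba, ha, hb⟩ := exists_listed_type (le_refl (kl.natAbs + jl.natAbs)) hn
  have htype : ∀ χ : HeckeCharacter K, χ.HasInfinityType (fun _ ↦ kl) (fun _ ↦ jl) →
      (χ * η).HasInfinityType (fun _ ↦ -(a : ℤ)) (fun _ ↦ (b : ℤ)) := by
    intro χ hχ
    have h := hχ.mul' hηt
    have e1 : ((fun _ ↦ kl : InfinitePlace K → ℤ) + fun _ ↦ -((2 * n : ℕ) : ℤ)) = fun _ ↦ -(a : ℤ) := by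
      funext w'
      simp only [Pi.add_apply, ha]
      ring
    have e2 : ((fun _ ↦ jl : InfinitePlace K → ℤ) + fun _ ↦ (n : ℤ)) = fun _ ↦ (b : ℤ) := by
      funext w'
      simp only [Pi.add_apply, hb]
    exact Eq.mp (congrArg₂ (fun f g ↦ (χ * η).HasInfinityType f g) e1 e2) h
  have hlamη : (lam * η).HasInfinityType (fun _ ↦ -(a : ℤ)) (fun _ ↦ (b : ℤ)) := htype lam hlam
  -- `λν` has the type of `λ`; `νη` is a listing twist with avatar `ψν · ψ`
  have hlamν : (lam * ν).HasInfinityType (fun _ ↦ kl) (fun _ ↦ jl) := by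
    have h := hlam.mul' hν.hasInfinityType_zero
    have e1 : ((fun _ ↦ kl : InfinitePlace K → ℤ) + fun _ ↦ 0) = fun _ ↦ kl := by funext w'; simp
    have e2 : ((fun _ ↦ jl : InfinitePlace K → ℤ) + fun _ ↦ 0) = fun _ ↦ jl := by funext w'; simp
    exact Eq.mp (congrArg₂ (fun f g ↦ (lam * ν).HasInfinityType f g) e1 e2) h
  have hlamνη : (lam * (ν * η)).HasInfinityType (fun _ ↦ -(a : ℤ)) (fun _ ↦ (b : ℤ)) := by
    rw [← mul_assoc]; exact htype _ hlamν
  have hνp : ∀ w : HeightOneSpectrum (𝓞 K), ((p : ℕ) : 𝓞 K) ∉ w.asIdeal → ν.IsUnramifiedAt w :=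
    fun w hw ↦ hνu w (fun h ↦ hw (h ▸ hvbar))
  have heνη : IsPAdicAvatarOf ι (ν * η) (eU.comp (ψν * ψ)) :=
    isPAdicAvatarOf_mul ι heν he (hram_of_forall hνp (fun w _ ↦ hηu w))
  have heνηκ : FactorsThroughPair κ₁ κ₂ (eU.comp (ψν * ψ)) := by
    intro σ hσ₁ hσ₂
    have hA := hνκ σ hσ₁ hσ₂
    have hB := heκ σ hσ₁ hσ₂
    rw [ContinuousMonoidHom.coe_comp, Function.comp_apply] at hA hB ⊢
    rw [ContinuousMonoidHom.mul_apply, map_mul, hA, hB, mul_one]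
  have hνηu : ∀ w : HeightOneSpectrum (𝓞 K), w ≠ vbar → (ν * η).IsUnramifiedAt w :=
    fun w hw ↦ (hνu w hw).mul' (hηu w)
  -- §2 at `η` and at `νη`: the same explicit value `E`
  have hYη := hasValueAt₂_rigidityUnit_at_listing_twist hK hv hvbar hne hι hlamu hpair he heκ (fun w _ ↦ hηu w)
    hba hlamη hG hG' hΩ hδ hΩp hΩ' hδ' hΩp' hG0 hU
  have hYνη := hasValueAt₂_rigidityUnit_at_listing_twist hK hv hvbar hne hι hlamu hpair heνη heνηκ hνηu
    hba hlamνη hG hG' hΩ hδ hΩp hΩ' hδ' hΩp' hG0 hU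
  -- the explicit shape of `U` (file 3 at `η`) and its values
  obtain ⟨c₀, x, w, s₁, s₂, hs₁, hs₂, -, -, -, -, hEq⟩ := exists_eq_unitTwist₂_mul_of_listing_twist hK hv hvbar
    hne hι hlamu hpair he heκ (fun w _ ↦ hηu w) hba hlamη hG hG' hΩ hδ hΩp hΩ' hδ' hΩp' hG0
  have hUeq : U = IntSeries.unitTwist₂ (PowerSeries.C (PowerSeries.C c₀) *
      (PowerSeries.map (PowerSeries.C (R := PadicComplexInt p)) (IntSeries.binomPow x) *
        PowerSeries.C (IntSeries.binomPow w))) s₁ s₂ :=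
    mul_right_cancel₀ hG0 (hU.symm.trans hEq)
  -- the three points: `η`, `ν`, `νη` (all principal units) and the origin
  set tη₁ := avatarValueAt (eU.comp ψ) γ₁ with htη₁
  set tη₂ := avatarValueAt (eU.comp ψ) γ₂ with htη₂
  set tν₁ := avatarValueAt (eU.comp ψν) γ₁ with htν₁
  set tν₂ := avatarValueAt (eU.comp ψν) γ₂ with htν₂
  have hη₁ : ‖tη₁ - 1‖ < 1 := norm_avatarValueAt_sub_one_lt_of_factorsThroughPair heκ γ₁
  have hη₂ : ‖tη₂ - 1‖ < 1 := norm_avatarValueAt_sub_one_lt_of_factorsThroughPair heκ γ₂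
  have hν₁ : ‖tν₁ - 1‖ < 1 := norm_avatarValueAt_sub_one_lt_of_factorsThroughPair hνκ γ₁
  have hν₂ : ‖tν₂ - 1‖ < 1 := norm_avatarValueAt_sub_one_lt_of_factorsThroughPair hνκ γ₂
  have hprod₁ : avatarValueAt (eU.comp (ψν * ψ)) γ₁ = tν₁ * tη₁ := by
    rw [htν₁, htη₁, heU, avatarValueAt_unitsChar_mul]
  have hprod₂ : avatarValueAt (eU.comp (ψν * ψ)) γ₂ = tν₂ * tη₂ := by
    rw [htν₂, htη₂, heU, avatarValueAt_unitsChar_mul]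
  -- values of `U` from the explicit shape
  have V : ∀ {X Y : ℂ_[p]}, ‖X‖ < 1 → ‖Y‖ < 1 → IntSeries.HasValueAt₂ U X Y
      ((c₀ : ℂ_[p]) * (IntSeries.onePlusPow x ((s₁ : ℂ_[p]) * (1 + X) - 1) *
        IntSeries.onePlusPow w ((s₂ : ℂ_[p]) * (1 + Y) - 1))) := by
    intro X Y hX hY
    rw [hUeq]
    exact hasValueAt₂_twistedUnit hs₁ hs₂ hX hY
  have h0 : ‖(0 : ℂ_[p])‖ < 1 := by rw [norm_zero]; exact one_pos
  -- name the four values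
  have Vη := V hη₁ hη₂
  have Vνη := V (X := tν₁ * tη₁ - 1) (Y := tν₂ * tη₂ - 1) (norm_mul_sub_one_lt hν₁ hη₁) (norm_mul_sub_one_lt hν₂ hη₂)
  have Vν := V hν₁ hν₂
  have V1 := V h0 h0
  rw [hprod₁, hprod₂] at hYνη
  -- `U(P η) = E = U(P(νη))`
  have eq1 := Vη.unique hYη
  have eq2 := Vνη.unique hYνη
  -- multiplicativity: `U(P(νη))·U(0,0) = U(P ν)·U(P η)`
  have hmul := twistedUnitValue_mul (c₀ := (c₀ : ℂ_[p])) (x := x) (w := w) hs₁ hs₂ hν₁ hν₂ hη₁ hη₂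
  simp only [add_sub_cancel] at eq1 eq2 Vν
  simp only [add_zero] at V1
  refine ⟨_, V1, ?_⟩
  -- compare
  have hE0 : ((((ι.symm (Ω / Ω')) : PadicAlgCl p) : ℂ_[p]) * (Ωp' / Ωp)) ^ (a + b) *
      (((ι.symm (δ / δ')) : PadicAlgCl p) : ℂ_[p]) ^ b ≠ 0 := by
    have hιne : ∀ z : ℂ, z ≠ 0 → (((ι.symm z) : PadicAlgCl p) : ℂ_[p]) ≠ 0 := fun z hz ↦ by
      rw [PadicComplex.coe_eq, map_ne_zero_iff _ (algebraMap (PadicAlgCl p) ℂ_[p]).injective,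
        map_ne_zero_iff _ ι.symm.injective]
      exact hz
    exact mul_ne_zero (pow_ne_zero _ (mul_ne_zero (hιne _ (div_ne_zero hΩ hΩ')) (div_ne_zero hΩp' hΩp)))
      (pow_ne_zero _ (hιne _ (div_ne_zero hδ hδ')))
  have key : (c₀ : ℂ_[p]) * (IntSeries.onePlusPow x ((s₁ : ℂ_[p]) * tν₁ - 1) *
      IntSeries.onePlusPow w ((s₂ : ℂ_[p]) * tν₂ - 1)) =
      (c₀ : ℂ_[p]) * (IntSeries.onePlusPow x ((s₁ : ℂ_[p]) * 1 - 1) * IntSeries.onePlusPow w ((s₂ : ℂ_[p]) * 1 - 1)) := by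
    have h := hmul
    rw [eq1, eq2] at h
    -- `E * U(0) = U(ν) * E`
    exact mul_right_cancel₀ hE0 (h.symm.trans (mul_comm _ _))
  rw [mul_one, mul_one] at key
  have Vν' := Vν
  rw [key] at Vν'
  convert Vν' using 2; ring

end Summit.BirchSwinnertonDyer.BirchSwinnertonDyer.Theorems.GoodLatticeKatzMeasureRigidityUnitValues

end
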